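import Mathlib
import Summits.Ventures.PercRepro.TriangleCapFourBelowTwelve
import Summits.Ventures.PercRepro.TriangleCapFourBelowAssemblyB

/-!
# PercRepro — THE `r = 4` ASSEMBLY FOR `k ≥ 12` (p3, gen 39; part 138)

The assemblies of parts 127 and 129 re-run with the `k = 12` windmill of part 137: every case of the dense
corner but the one-triangle graphs with few outer vertices, for `k ≥ 12`
(`dense_stability_four_modulo_one_triangle_twelve`, `dense_stability_four_modulo_few_outer_twelve`).
Axioms: standard.
-/

namespace PercRepro

namespace TriangleCap

namespace C047

open Finset

variable {V : Type*} [Fintype V] [DecidableEq V]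

/-- **THE `r = 4` STABILITY OF THE DENSE CORNER FOR `k ≥ 12`, MODULO THE ONE-TRIANGLE CASE:** `K₄⁻`-free,
`2m ≥ 6k − 26`, no product `a′ (k − a′)` among `m, …, m + 3`, and the one-triangle case as a hypothesis ⇒
`Σ_v d(v)² + 4 (k − 5) ≤ m k`. -/
theorem dense_stability_four_modulo_one_triangle_twelve (D : SimpleGraph V) [DecidableRel D.Adj] (hK : K4mFree D)
    (hk : 12 ≤ Fintype.card V) (hm : 6 * Fintype.card V ≤ 2 * D.edgeFinset.card + 26)
    (hprod : ∀ a', a' ≤ Fintype.card V → D.edgeFinset.card ≠ a' * (Fintype.card V - a') ∧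
      D.edgeFinset.card + 1 ≠ a' * (Fintype.card V - a') ∧ D.edgeFinset.card + 2 ≠ a' * (Fintype.card V - a') ∧
      D.edgeFinset.card + 3 ≠ a' * (Fintype.card V - a'))
    (hone : ∀ u v w, D.Adj u v → D.Adj u w → D.Adj v w →
      (∀ a b c, D.Adj a b → D.Adj a c → D.Adj b c → a = u ∨ a = v ∨ a = w) → (∀ z, 2 ≤ deg D z) →
      ∑ v, deg D v * deg D v + 4 * (Fintype.card V - 5) ≤ D.edgeFinset.card * Fintype.card V) :
    ∑ v, deg D v * deg D v + 4 * (Fintype.card V - 5) ≤ D.edgeFinset.card * Fintype.card V := by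
  have hk10 : 10 ≤ Fintype.card V := by omega
  -- a vertex of degree `≤ 1`: deletion
  by_cases hdeg : ∀ z, 2 ≤ deg D z
  swap
  · push Not at hdeg
    obtain ⟨z, hz⟩ := hdeg
    rcases Nat.lt_or_ge (deg D z) 1 with h0 | h1
    · exact stability_four_of_isolated D hK hk10 hm hprod (z := z) (by omega)
    · exact stability_four_of_pendant D hK hk10 hm hprod (z := z) (by omega)
  -- no bipartition with `≤ 3` missing pairs
  have hnot : ¬ ∃ A : Finset V, (∀ x y, D.Adj x y → (x ∈ A ↔ y ∉ A)) ∧ (missing D A Aᶜ).card ≤ 3 := by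
    rintro ⟨A, hA, hN⟩
    have hNX := card_missing_add_card_edges D A hA
    have hXc : Aᶜ.card = Fintype.card V - A.card := by
      have := card_add_card_compl A
      omega
    have hXk : A.card ≤ Fintype.card V := card_le_univ A
    obtain ⟨h1, h2, h3, h4⟩ := hprod A.card hXk
    rw [hXc] at hNX
    have : (missing D A Aᶜ).card = 0 ∨ (missing D A Aᶜ).card = 1 ∨ (missing D A Aᶜ).card = 2 ∨
        (missing D A Aᶜ).card = 3 := by omega
    rcases this with h | h | h | h
    · rw [h] at hNX; exact h1 (by omega)
    · rw [h] at hNX; exact h2 (by omega)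
    · rw [h] at hNX; exact h3 (by omega)
    · rw [h] at hNX; exact h4 (by omega)
  by_cases hfree : D.CliqueFree 3
  · exact triangle_free_stability_four D hfree hk10 hm hdeg hnot
  obtain ⟨S, hS⟩ := not_forall.mp hfree
  have hS' := not_not.mp hS
  rw [SimpleGraph.is3Clique_iff] at hS'
  obtain ⟨u, v, w, huv, huw, hvw, -⟩ := hS'
  by_cases hT : ∀ a b c, D.Adj a b → D.Adj a c → D.Adj b c → a = u ∨ a = v ∨ a = w
  · exact hone u v w huv huw hvw hT hdeg
  simp only [not_forall, not_or] at hT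
  obtain ⟨a, b, c, hab, hac, hbc, hau, hav, haw⟩ := hT
  have ha : ¬ (a = u ∨ a = v ∨ a = w) := fun h => by
    rcases h with h | h | h
    · exact hau h
    · exact hav h
    · exact haw h
  by_cases hT3 : ∀ x y z, D.Adj x y → D.Adj x z → D.Adj y z → x = u ∨ x = v ∨ x = w ∨ x = a ∨ x = b ∨ x = c
  · -- TWO TRIANGLES
    by_cases hdisj : ∀ t, (t = u ∨ t = v ∨ t = w) → ¬ (t = a ∨ t = b ∨ t = c)
    · exact two_triangles_stability_four_of_disjoint D hK hk10 hm huv huw hvw hab hac hbc hT3 hdisj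
    · simp only [not_forall, not_not, exists_prop] at hdisj
      obtain ⟨t, ht1, ht2⟩ := hdisj
      exact two_triangles_stability_four_of_shared D hK (by omega) hm hdeg huv huw hvw hab hac hbc ha hT3 ⟨ht1, ht2⟩
  simp only [not_forall, not_or] at hT3
  obtain ⟨x, y, z, hxy, hxz, hyz, hxu, hxv, hxw, hxa, hxb, hxc⟩ := hT3
  have hx : ¬ (x = u ∨ x = v ∨ x = w ∨ x = a ∨ x = b ∨ x = c) := fun h => by
    rcases h with h | h | h | h | h | h
    · exact hxu h
    · exact hxv h
    · exact hxw h
    · exact hxa h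
    · exact hxb h
    · exact hxc h
  set T₁ : Finset V := {u, v, w} with hT₁
  set T₂ : Finset V := {a, b, c} with hT₂
  set T₃ : Finset V := {x, y, z} with hT₃
  by_cases hT4 : ∀ x' y' z', D.Adj x' y' → D.Adj x' z' → D.Adj y' z' →
      (x' ∈ T₁ ∧ y' ∈ T₁) ∨ (x' ∈ T₂ ∧ y' ∈ T₂) ∨ (x' ∈ T₃ ∧ y' ∈ T₃)
  · -- THREE TRIANGLES
    exact three_triangles_stability_four_of_twelve D hK hk hm hdeg huv huw hvw hab hac hbc hxy hxz hyz ha hx hT4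
  have h₁ : T₁.card = 3 := card_triple huv.ne huw.ne hvw.ne
  have h₂ : T₂.card = 3 := card_triple hab.ne hac.ne hbc.ne
  have h₃ : T₃.card = 3 := card_triple hxy.ne hxz.ne hyz.ne
  have hcl₁ := clique_triple D huv huw hvw
  have hcl₂ := clique_triple D hab hac hbc
  have hcl₃ := clique_triple D hxy hxz hyz
  have hx1 : ¬ (x = u ∨ x = v ∨ x = w) := fun h => hx (by tauto)
  have hx2 : ¬ (x = a ∨ x = b ∨ x = c) := fun h => hx (by tauto)
  have hi12 : (T₁ ∩ T₂).card ≤ 1 := inter_card_le_one_of_triangles D hK huv huw hvw hab hac hbc ha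
  have hi13 : (T₁ ∩ T₃).card ≤ 1 := inter_card_le_one_of_triangles D hK huv huw hvw hxy hxz hyz hx1
  have hi23 : (T₂ ∩ T₃).card ≤ 1 := inter_card_le_one_of_triangles D hK hab hac hbc hxy hxz hyz hx2
  simp only [not_forall, not_or] at hT4
  obtain ⟨x', y', z', hxy', hxz', hyz', h1, h2, h3⟩ := hT4
  set T₄ : Finset V := {x', y', z'} with hT₄
  have h₄ : T₄.card = 3 := card_triple hxy'.ne hxz'.ne hyz'.ne
  have hcl₄ := clique_triple D hxy' hxz' hyz'
  have hx'4 : x' ∈ T₄ := by rw [hT₄]; exact mem_insert_self _ _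
  have hy'4 : y' ∈ T₄ := by rw [hT₄]; exact mem_insert_of_mem (mem_insert_self _ _)
  have hne1 : T₄ ≠ T₁ := fun h => h1 ⟨h ▸ hx'4, h ▸ hy'4⟩
  have hne2 : T₄ ≠ T₂ := fun h => h2 ⟨h ▸ hx'4, h ▸ hy'4⟩
  have hne3 : T₄ ≠ T₃ := fun h => h3 ⟨h ▸ hx'4, h ▸ hy'4⟩
  have hne12 : T₁ ≠ T₂ := fun h => by rw [h, inter_self, h₂] at hi12; omega
  have hne13 : T₁ ≠ T₃ := fun h => by rw [h, inter_self, h₃] at hi13; omega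
  have hne23 : T₂ ≠ T₃ := fun h => by rw [h, inter_self, h₃] at hi23; omega
  by_cases hT5 : ∀ x'' y'' z'', D.Adj x'' y'' → D.Adj x'' z'' → D.Adj y'' z'' →
      (x'' ∈ T₁ ∧ y'' ∈ T₁) ∨ (x'' ∈ T₂ ∧ y'' ∈ T₂) ∨ (x'' ∈ T₃ ∧ y'' ∈ T₃) ∨ (x'' ∈ T₄ ∧ y'' ∈ T₄)
  · -- FOUR TRIANGLES
    exact four_triangles_stability_four_of_ten D hK hk10 hm T₁ T₂ T₃ T₄ h₁ h₂ h₃ h₄ hcl₁ hcl₂ hcl₃ hcl₄ hne12 hne13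
      (Ne.symm hne1) hne23 (Ne.symm hne2) (Ne.symm hne3) hT5
  -- FIVE OR MORE TRIANGLES: `|T₃| ≥ 30` and the envelope
  simp only [not_forall, not_or] at hT5
  obtain ⟨x'', y'', z'', hxy'', hxz'', hyz'', g1, g2, g3, g4⟩ := hT5
  set T₅ : Finset V := {x'', y'', z''} with hT₅
  have hx''5 : x'' ∈ T₅ := by rw [hT₅]; exact mem_insert_self _ _
  have hy''5 : y'' ∈ T₅ := by rw [hT₅]; exact mem_insert_of_mem (mem_insert_self _ _)
  have hne51 : T₅ ≠ T₁ := fun h => g1 ⟨h ▸ hx''5, h ▸ hy''5⟩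
  have hne52 : T₅ ≠ T₂ := fun h => g2 ⟨h ▸ hx''5, h ▸ hy''5⟩
  have hne53 : T₅ ≠ T₃ := fun h => g3 ⟨h ▸ hx''5, h ▸ hy''5⟩
  have hne54 : T₅ ≠ T₄ := fun h => g4 ⟨h ▸ hx''5, h ▸ hy''5⟩
  have hF : ({T₁, T₂, T₃, T₄, T₅} : Finset (Finset V)).card = 5 := by
    rw [card_insert_of_notMem, card_insert_of_notMem, card_insert_of_notMem, card_insert_of_notMem,
      card_singleton]
    · rw [mem_singleton]; exact Ne.symm hne54
    · rw [mem_insert, mem_singleton, not_or]; exact ⟨Ne.symm hne3, Ne.symm hne53⟩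
    · rw [mem_insert, mem_insert, mem_singleton, not_or, not_or]; exact ⟨hne23, Ne.symm hne2, Ne.symm hne52⟩
    · rw [mem_insert, mem_insert, mem_insert, mem_singleton, not_or, not_or, not_or]
      exact ⟨hne12, hne13, Ne.symm hne1, Ne.symm hne51⟩
  have h30 := six_mul_card_le_card_triangles3 D {T₁, T₂, T₃, T₄, T₅} (by
    intro T hT'
    simp only [mem_insert, mem_singleton] at hT'
    rcases hT' with rfl | rfl | rfl | rfl | rfl
    · exact ⟨u, v, w, huv, huw, hvw, rfl⟩
    · exact ⟨a, b, c, hab, hac, hbc, rfl⟩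
    · exact ⟨x, y, z, hxy, hxz, hyz, rfl⟩
    · exact ⟨x', y', z', hxy', hxz', hyz', rfl⟩
    · exact ⟨x'', y'', z'', hxy'', hxz'', hyz'', rfl⟩)
  rw [hF] at h30
  apply stability_of_triangles D hK (by omega) 5 4 h30
  obtain ⟨k', hk'⟩ : ∃ k', Fintype.card V = k' + 10 := ⟨Fintype.card V - 10, by omega⟩
  rw [hk']
  have e1 : k' + 10 - 4 - 1 = k' + 5 := by omega
  have e2 : k' + 10 - 6 = k' + 4 := by omega
  rw [e1, e2]
  nlinarith

/-- **THE `r = 4` STABILITY FOR `k ≥ 12` MODULO THE ONE-TRIANGLE GRAPHS WITH FEW OUTER VERTICES.** -/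
theorem dense_stability_four_modulo_few_outer_twelve (D : SimpleGraph V) [DecidableRel D.Adj] (hK : K4mFree D)
    (hk : 12 ≤ Fintype.card V) (hm : 6 * Fintype.card V ≤ 2 * D.edgeFinset.card + 26)
    (hprod : ∀ a', a' ≤ Fintype.card V → D.edgeFinset.card ≠ a' * (Fintype.card V - a') ∧
      D.edgeFinset.card + 1 ≠ a' * (Fintype.card V - a') ∧ D.edgeFinset.card + 2 ≠ a' * (Fintype.card V - a') ∧
      D.edgeFinset.card + 3 ≠ a' * (Fintype.card V - a'))
    (hone : ∀ u v w, D.Adj u v → D.Adj u w → D.Adj v w →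
      (∀ a b c, D.Adj a b → D.Adj a c → D.Adj b c → a = u ∨ a = v ∨ a = w) → (∀ z, 2 ≤ deg D z) →
      10 * ((({u, v, w} : Finset V)ᶜ).filter (fun z => degIn D {u, v, w} z = 0)).card + 2 * D.edgeFinset.card + 28 <
        8 * Fintype.card V →
      (((({u, v, w} : Finset V)ᶜ).filter (fun z => degIn D {u, v, w} z = 0)).card ≤ 4 ∨
        3 * Fintype.card V ≤ D.edgeFinset.card) →
      ∑ v, deg D v * deg D v + 4 * (Fintype.card V - 5) ≤ D.edgeFinset.card * Fintype.card V) :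
    ∑ v, deg D v * deg D v + 4 * (Fintype.card V - 5) ≤ D.edgeFinset.card * Fintype.card V := by
  apply dense_stability_four_modulo_one_triangle_twelve D hK hk hm hprod
  intro u v w huv huw hvw hT hdeg
  by_cases hpay : 8 * Fintype.card V ≤
      10 * ((({u, v, w} : Finset V)ᶜ).filter (fun z => degIn D {u, v, w} z = 0)).card + 2 * D.edgeFinset.card + 28
  · exact one_triangle_stability_four_of_outer' D hK huv huw hvw hT (by omega) hdeg hpay
  push Not at hpay
  by_cases hq : ((({u, v, w} : Finset V)ᶜ).filter (fun z => degIn D {u, v, w} z = 0)).card ≤ 4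
  · exact hone u v w huv huw hvw hT hdeg hpay (Or.inl hq)
  push Not at hq
  by_cases hm3 : D.edgeFinset.card + 1 ≤ 3 * Fintype.card V
  · exact one_triangle_stability_four_of_five_outer D hK huv huw hvw hT (by omega) hdeg (by omega) hm3
  · exact hone u v w huv huw hvw hT hdeg hpay (Or.inr (by omega))

end C047

end TriangleCap

end PercRepro
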